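import Mathlib
import Summits.Ventures.HodgeRepro0.P5Dim8Tbar2222
import Summits.Ventures.HodgeRepro0.P2Dim8H1H2Lattice

/-!
# P2Dim8H1H2LatticeB — the group `T` of `P2Dim8H1H2Lattice` lies in T̄ class 3 of `P5Dim8Tbar2222` (the index ↔ class identification by name)
(seat p2 (g4), pub-hodge-repro0; the lead's criterion (a) of STATUS l.2293)

`P2Dim8H1H2Lattice.T` is the group of T class 1980 of the stage-A file `ts_2_2_2_2_3.json.gz` — T̄ class 3 of the (2,2,2,2) census.
Its image T̄ in the block-swap group F₂⁴ is the set of block-swap vectors of its 8 elements: the element `t` swaps the two ι-pairs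
`{4b, 4b+2}`, `{4b+1, 4b+3}` of the surface block `b` iff `t (4b) ∈ {4b+1, 4b+3}` (p5's point convention `pt(b, j, e) = 4b + j + 2e`,
ι: e ↦ 1 − e), and the vector is encoded as the bitmask with bit `b` set iff block `b` is swapped — exactly `P5Dim8Tbar2222`'s encoding.
Certified by `decide`: the 16-bit mask of this image equals `P5Dim8Tbar2222.classes.getD 3` = the span of `P5Dim8Tbar2222.gens.getD 3 =
[12, 3]` (the vectors 1100 and 0011: «blocks 2, 3 swapped» and «blocks 0, 1 swapped»), i.e. the subgroup `{0000, 0011, 1100, 1111}` =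
⟨1111, e₀ + e₁⟩ of Lemma 2.4.1 — T̄ class 3, one of the three classes {3, 6, 8} carrying the (h1)/(h2) rows; and that this image has
exactly 4 elements, so `T → T̄` has kernel of order 2 (= ⟨ι⟩, the sign subgroup `N = T ∩ D` of the census's Lemma 1.1 reading).
-/

namespace HodgeRepro0.P2Dim8H1H2LatticeB

open HodgeRepro0.P2Dim8H1H2Lattice in
/-- the block-swap vector of a permutation `t` of the 16 points, as a bitmask over the 4 blocks -/
def swapVec (t : List Nat) : Nat :=
  (List.range 4).foldl (fun m b => if ap t (4 * b) == 4 * b + 1 || ap t (4 * b) == 4 * b + 3 then m ||| (1 <<< b) else m) 0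

open HodgeRepro0.P2Dim8H1H2Lattice in
/-- the image T̄ of `T` in F₂⁴ as a 16-bit mask (bit `x` set iff the vector `x` is the swap vector of some `t ∈ T`) -/
def tbarMask : Nat := HodgeRepro0.P5Dim8Tbar2222.maskOf (T.map swapVec)

/-- the image of `T` in F₂⁴ is exactly T̄ class 3 of `P5Dim8Tbar2222` (the span of its generators `[12, 3]`), of order 4 -/
theorem tbar_is_class3 :
    tbarMask = HodgeRepro0.P5Dim8Tbar2222.classes.getD 3 0 ∧
    HodgeRepro0.P5Dim8Tbar2222.gens.getD 3 [] = [12, 3] ∧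
    HodgeRepro0.P5Dim8Tbar2222.order tbarMask = 4 ∧
    (HodgeRepro0.P5Dim8Tbar2222.elems tbarMask) = [0, 3, 12, 15] := by decide

end HodgeRepro0.P2Dim8H1H2LatticeB
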